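import Literature.MathematicalPhysics.QuantumFieldTheory.Balaban1983to89.B13RealSliceEntryLetters

/-!
# ⟨27930⟩ `stub_P0C`, SUPPLIER SIDE — THE (P4) REAL-SLICE SPLIT: piecewise two-constants transfer for the P0 letter's decay clause
(◇ lens-1 g16 NODE v22 (N3) «M-piece»; generic complex analysis over a `RealStructure`, Mathlib + ✓`B13RealSliceEntryLetters` only; consumer = node00-def-Y's `P0FamilySupply` BY
NAME, ★★★ №640 (2)(d))

LANDING NOTE (porter ▶ PTC-1 g5, 2026-08-31; AUTHORSHIP = ◇ lens-1 g16, HOME file `nodeO-cover/LENS1g16P4RealSlice.lean` sha16 5525b62469c484be · 163 l. ·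
4 thm + 1 `example` + 1 axioms guard; memo `nodeO-cover/LENS-1-NODE-v22-S3-KERNEL-SIDE-IS-P0C.md` §4 (N3)).  HOISTED on ★★★ director-ym №640 (4) (nodeO STATUS
2026-08-31T19:27:51Z): §1–§3 = the four theorems ★`pieceDecay_of_realSlice`, ★`rowDecay_of_realSlice`, `demandTransfer`, `realRate_le` VERBATIM (statements, proofs,
docstrings, namespace `…Theorems.BalabanUVNodesPortS1.Lens1P4RealSlice`, the one import); DROPPED per the same word: §4 the non-vacuity `example` (`f u = c₀e^{−δd}·e^{iu}` on `ℂ`,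
radii (1, 3), `M = c₀e³` — kept in the HOME file as the vacuity witness ◆ reads) and §5 the `#guard_msgs … #print axioms` line (the gate prints axioms itself); this paragraph
and the title replace the HOME header's «CELL SCRATCH — NOT for landing» line.  Filed `--supports stmt-QuantumFields-27930 --as helper` (NO `--workitem`; nothing registered is
closed) `--cite Balaban1985BackgroundPropagators --cite Ransford1995 --cite Balaban1988RG2Cluster`; chain INTENT → ★★ dag-lead DEDUP → ◇ lens-1 g16 second read → ◆ CRIT-1 CUT → file.
SOURCES as the memo cites them: [B9] = [Balaban1985BackgroundPropagators] (CMP **99** (1985) 389–434) Thm 3.4 p.400 (holomorphic extension of the OPERATORS with all inequalities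
of Thms 3.1–3.3; the walk TERMS' decay (3.94)∕(3.108) is displayed at REAL backgrounds only — ◇ g16 second-read wording) and
Cor. 3.8 (3.93)–(3.94) p.410 (the REAL-background decay the supplier's lattice rows are sourced from); [II] = [Balaban1988RG2Cluster] p.15 («α′₀, α′₁ much bigger than α₀, α₁»);
the two-constants theorem = [Ransford1995, Thm. 4.3.7] as typed in ✓`Literature…B13RealSliceEntryLetters` (`RealStructure`, `lam`, `lam_lt_one`, `lam_radii_le`, `norm_le_of_realSlice`).

WHAT.  The P0 letter `BalabanUVNodesK0RecordFormatNamesP0C.P0CarrierClauses` (P4) asks, for every piece `TY n Y` of the carrier of `Δ^{(k)}`,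
SCHUR row∕column decay `Σ_j ‖TY n Y φ i j‖ ≤ c₀·e^{−δ₀·dj Y}` at EVERY COMPLEX `φ` of the record space `recordUc … α₀ α₁ … Y`, the rate `δ₀`
DEMANDED by the consumer.  The supplier's printed source (node00-def-Y's word, HOME STATUS l.5375: [Balaban1985BackgroundPropagators] Cor. 3.8
(3.94)) is a REAL-background estimate; the complex half is the cell's catalogued gap G-B9-10.  The N10 lane (dag-n10-c module 38 ∕ 40 =
`B13RealSliceEntryLetters`, ROUTE-P2 §S58) closed the same gap for ENTRY letters by Nevanlinna's two-constants theorem along one complex line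
through the real slice.  This file records that the SAME tree lemma (`norm_le_of_realSlice`, norm-generic) transfers the P0 letter's PIECE
letter: §1 one piece, any complex normed target; §2 the SCHUR ROW FORM — the row read as ONE holomorphic `ℓ¹`-vector, so the row SUM transfers
with NO site-count factor (▶ PT-A-1 (c6a)); §3 the demand transfer `(1−λ)·(δ₀∕(1−λ)) = δ₀` (Q-order: `λ` is supplier-side, fixed before the
consumer announces `δ₀`) and the bound `realRate_le` on the real-slice rate to supply.

HONEST LIMITS.  Abstract complex analysis over a `RealStructure`; which configurations of the record chart are «real» and whether the
two-constants LINE through a point of `recordUc(α₀,α₁)` stays inside `recordUc(α₀′,α₁′)` (print [II] p.15 «α′₀, α′₁ much bigger») is a radii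
lemma on `Sect2.frameI ∕ space'` NOT done here (the lane's open pin R-28.2, shared); the F-uniform rate-free bound `M` of the pieces on the
outer domain is a supplier input ([B9] Thm 3.4 first sentence ∕ [15] Prop. 9 type).  A TRANSFER lemma, not an estimate of Bałaban's: nothing of
[B9] (3.94) ∕ Thm 3.4 is asserted, ported or discharged; `stub_P0C`, (P4) and every letter named stay OPEN and inhabited NOWHERE; ⟨27930⟩, K0ᴬ ⟨27238⟩,
K0⁷ OPEN; NODE O 0∕1; COUNT 8∕28 · K 1∕4 UNMOVED; finite 𝕋⁴ at fixed ε — NOT continuum ∕ OS ∕ Clay; the Yang–Mills mass gap is NOT proved by any of this.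
-/

noncomputable section

namespace Summit.QuantumFields.YangMills.Theorems.BalabanUVNodesPortS1.Lens1P4RealSlice

open Metric Set
open Literature.MathematicalPhysics.QuantumFieldTheory.Balaban1983to89.B13RealSliceEntryLetters
  (RealStructure lam lam_nonneg lam_lt_one lam_radii_le norm_le_of_realSlice realStructureComplex)

variable {E : Type*} [NormedAddCommGroup E] [NormedSpace ℂ E]
variable {F : Type*} [NormedAddCommGroup F] [NormedSpace ℂ F]

/-! ## §1  One piece, any complex normed target -/

/-- **(P4) REAL-SLICE TRANSFER, ONE PIECE.**  `f : E → F` holomorphic on the ball `R_an`, a RATE-FREE bound `‖f‖ ≤ M` there, and the piece's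
decay VALUE `‖f v‖ ≤ c₀·e^{−δ·d}` on the REAL configurations of that ball (`d` = the piece's tree length `dj Y`, a number) ⟹ on the ball `R₀`
(`2R₀ < R_an`): `‖f u‖ ≤ c₀^{1−λ}·M^{λ}·e^{−(1−λ)·δ·d}`, `λ = λ(R₀∕(R_an−R₀)) ≤ (4∕π)·R₀∕(R_an−R₀)` (`lam_radii_le`).
By `norm_le_of_realSlice` BY NAME + the radii rewrite of `rawEntryLetters_of_realSlice_radii`. -/
theorem pieceDecay_of_realSlice (ℛ : RealStructure E) {f : E → F} {Ran R₀ c₀ M δ d : ℝ}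
    (hR₀ : 0 < R₀) (h2 : 2 * R₀ < Ran)
    (hf : DifferentiableOn ℂ f (ball (0 : E) Ran))
    (hM : ∀ u ∈ ball (0 : E) Ran, ‖f u‖ ≤ M)
    (hreal : ∀ v ∈ ℛ.Ereal, ‖v‖ < Ran → ‖f v‖ ≤ c₀ * Real.exp (-(δ * d)))
    (hc₀ : 0 ≤ c₀) (hcM : c₀ ≤ M) (hδ : 0 ≤ δ) (hd : 0 ≤ d) :
    ∀ u ∈ ball (0 : E) R₀,
      ‖f u‖ ≤ c₀ ^ (1 - lam (R₀ / (Ran - R₀))) * M ^ lam (R₀ / (Ran - R₀)) *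
        Real.exp (-((1 - lam (R₀ / (Ran - R₀))) * δ * d)) := by
  have hdpos : 0 < Ran - R₀ := by linarith
  have hd' : Ran - R₀ ≠ 0 := hdpos.ne'
  have hr0 : 0 < R₀ / (Ran - R₀) := div_pos hR₀ hdpos
  have hr1 : R₀ / (Ran - R₀) < 1 := (div_lt_one hdpos).2 (by linarith)
  have hm0 : 0 ≤ c₀ * Real.exp (-(δ * d)) := mul_nonneg hc₀ (Real.exp_nonneg _)
  have hexp1 : Real.exp (-(δ * d)) ≤ 1 := Real.exp_le_one_iff.2 (neg_nonpos.2 (mul_nonneg hδ hd))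
  have hmM : c₀ * Real.exp (-(δ * d)) ≤ M := (mul_le_of_le_one_right hc₀ hexp1).trans hcM
  have key := norm_le_of_realSlice ℛ hf hM hreal hm0 hmM hr0 hr1
  have e : R₀ / (Ran - R₀) / (1 + R₀ / (Ran - R₀)) * Ran = R₀ := by
    field_simp
    ring
  rw [e] at key
  intro u hu
  have hrew : (c₀ * Real.exp (-(δ * d))) ^ (1 - lam (R₀ / (Ran - R₀))) * M ^ lam (R₀ / (Ran - R₀))
      = c₀ ^ (1 - lam (R₀ / (Ran - R₀))) * M ^ lam (R₀ / (Ran - R₀)) *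
          Real.exp (-((1 - lam (R₀ / (Ran - R₀))) * δ * d)) := by
    rw [Real.mul_rpow hc₀ (Real.exp_nonneg _), ← Real.exp_mul]
    have : -(δ * d) * (1 - lam (R₀ / (Ran - R₀))) = -((1 - lam (R₀ / (Ran - R₀))) * δ * d) := by ring
    rw [this]; ring
  exact (key u hu).trans_eq hrew

/-! ## §2  The SCHUR ROW FORM of (P4): the row as one holomorphic `ℓ¹`-vector — no site count -/

/-- **(P4) REAL-SLICE TRANSFER, SCHUR ROW FORM.**  A matrix ROW `u ↦ (j ↦ T(u)_{ij})` read as ONE holomorphic map into `ℓ¹(n)` (`PiLp 1`):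
rate-free ROW-SUM bound `M` on the ball `R_an` + row-sum decay `c₀·e^{−δ·d}` on the real slice ⟹ row-sum decay
`c₀^{1−λ}·M^{λ}·e^{−(1−λ)δ·d}` on the ball `R₀` — the SUM of norms transfers as a norm (subharmonicity of `log ‖·‖` for ANY norm), so NO factor
`(#columns)^{λ}` = no site count per cube (▶ PT-A-1 (c6a)).  Columns: the same on the transpose. -/
theorem rowDecay_of_realSlice (ℛ : RealStructure E) {n : Type} [Fintype n] {g : E → PiLp 1 (fun _ : n => ℂ)}
    {Ran R₀ c₀ M δ d : ℝ} (hR₀ : 0 < R₀) (h2 : 2 * R₀ < Ran)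
    (hg : DifferentiableOn ℂ g (ball (0 : E) Ran))
    (hM : ∀ u ∈ ball (0 : E) Ran, ∑ j, ‖g u j‖ ≤ M)
    (hreal : ∀ v ∈ ℛ.Ereal, ‖v‖ < Ran → ∑ j, ‖g v j‖ ≤ c₀ * Real.exp (-(δ * d)))
    (hc₀ : 0 ≤ c₀) (hcM : c₀ ≤ M) (hδ : 0 ≤ δ) (hd : 0 ≤ d) :
    ∀ u ∈ ball (0 : E) R₀,
      ∑ j, ‖g u j‖ ≤ c₀ ^ (1 - lam (R₀ / (Ran - R₀))) * M ^ lam (R₀ / (Ran - R₀)) *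
        Real.exp (-((1 - lam (R₀ / (Ran - R₀))) * δ * d)) := by
  have hM' : ∀ u ∈ ball (0 : E) Ran, ‖g u‖ ≤ M := fun u hu => by
    rw [PiLp.norm_eq_of_L1]; exact hM u hu
  have hreal' : ∀ v ∈ ℛ.Ereal, ‖v‖ < Ran → ‖g v‖ ≤ c₀ * Real.exp (-(δ * d)) := fun v hv hvR => by
    rw [PiLp.norm_eq_of_L1]; exact hreal v hv hvR
  intro u hu
  have key := pieceDecay_of_realSlice ℛ hR₀ h2 hg hM' hreal' hc₀ hcM hδ hd u hu
  rwa [PiLp.norm_eq_of_L1] at key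

/-! ## §3  Demand transfer (Q-order of `P0HolExtAtRecord`: `δ₀` DEMANDED; `λ` supplier-side, fixed first) -/

/-- To MEET a demanded complex-domain rate `δ₀` it suffices to supply the REAL-slice rate `δ₀∕(1−λ)`: `(1−λ)·(δ₀∕(1−λ)) = δ₀` (`λ < 1` by
`lam_lt_one`).  The constant becomes `c₀^{1−λ}M^{λ}` — harmless: the letter quantifies `∀ c₀`, thresholds after it. -/
theorem demandTransfer (r δ₀ : ℝ) : (1 - lam r) * (δ₀ / (1 - lam r)) = δ₀ := by
  have h : 1 - lam r ≠ 0 := ne_of_gt (by linarith [lam_lt_one r])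
  field_simp

/-- The real-slice rate to supply is at most `δ₀ ∕ (1 − (4∕π)·R₀∕(R_an−R₀))` when that denominator is positive (e.g. `R_an ≥ 3R₀`:
`λ ≤ 2∕π < 0.64`, real rate `≤ 2.76·δ₀`). -/
theorem realRate_le {Ran R₀ δ₀ : ℝ} (hR₀ : 0 ≤ R₀) (h2 : 2 * R₀ < Ran) (hδ₀ : 0 ≤ δ₀)
    (hden : 0 < 1 - 4 / Real.pi * (R₀ / (Ran - R₀))) :
    δ₀ / (1 - lam (R₀ / (Ran - R₀))) ≤ δ₀ / (1 - 4 / Real.pi * (R₀ / (Ran - R₀))) := by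
  have hl := lam_radii_le hR₀ h2
  have h1 : 1 - 4 / Real.pi * (R₀ / (Ran - R₀)) ≤ 1 - lam (R₀ / (Ran - R₀)) := by linarith
  exact div_le_div_of_nonneg_left hδ₀ hden h1

end Summit.QuantumFields.YangMills.Theorems.BalabanUVNodesPortS1.Lens1P4RealSlice
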